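import Literature.Analysis.FluidPDE.TaoCascadeDuhamel
import Mathlib.Analysis.Normed.Ring.InfiniteSum
import HarnessLib

/-!
# `PerpetualPump.PumpTransfer` (stmt-NavierStokesRegularity-1837), line `Sketch`: scalar bounds for the heat fibres

Helper file (theorems only) for the registered stub `stub_bandField_exists` of the lead's skeleton
`Cruxes/PumpTransfer/Lines/Sketch.lean` (lead prover prover-line-stmt-NavierStokesRegularity-1837-0):
elementary real-variable bounds on the scalar heat fibres `duhamelScalar δ Qr L t` and on the circuit
nonlinearity `TaoCascade.quadTerm`, and the summability of the resulting mode bounds over the scales.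

Vocabulary: Tao's cascade operator (4.1) with wavelet data `𝒟 : CascadeWaveletData ε₀ m`
(`Literature/Analysis/FluidPDE/TaoCascadeOperator.lean`), the heat fibres `duhamelScalar δ Qr L t`,
weights `modeWeight 𝒟 i n = |ψ̂_{i,n}|²` and `modeDelta` (`TaoCascadeDuhamel.lean`), `heatRate ξ = 4π²|ξ|²`
(`TaoBandHeatGroup.lean`), the circuit nonlinearity `TaoCascade.quadTerm` (`TaoCascadeODE.lean`).

## Contents

* `abs_duhamelScalar_le_of_nonneg`: for `L, t ≥ 0`, `|φ_L(t)| ≤ |δ| + t·sup_{[0,t]}|Qr|`;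
* `abs_quadTerm_le`: from `(1+(1+ε₀)^{10k})|X_{j,k}(s)| ≤ C`,
  `|quadTerm_{i,n}(X(s))| ≤ K_α ((1+ε₀)^{2n}+(1+ε₀)^{3n}) (2^{10}C/(1+(1+ε₀)^{10n}))²`, `K_α = ∑|α|`
  (`weight_shift_le`: neighbouring scales have comparable weights; `rpow_five_halves_le`);
* `summable_decay`: `∑_{n∈ℤ} ((aⁿ)²+(aⁿ)³)²/(1+(aⁿ)^{10})² < ∞` for `a > 1`.

## References

* T. Tao, J. Amer. Math. Soc. 29 (2016), 601–674 = arXiv:1402.0290v3, §4 Lemma 4.1 (4.14). [`Tao2016AveragedNS`]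
-/

noncomputable section

-- the nested summit namespace is the tree's layout (D-0017)
set_option linter.dupNamespace false

namespace Summit.NavierStokesRegularity.NavierStokesRegularity.Theorems.PerpetualPumpPumpTransfer

open MeasureTheory Set Filter Topology FourierTransform
open scoped ENNReal SchwartzMap ComplexConjugate
open Literature.Analysis Literature.Analysis.FluidPDE Literature.Analysis.FluidPDE.Tao2016

variable {ε₀ : ℝ} {m : ℕ}

/-! ### Scalar bounds: the fibres, the nonlinearity, summability -/

/-- **The heat fibre for `t ≥ 0`, `L ≥ 0`**: `|φ_L(t)| ≤ |δ| + t · sup_{[0,t]} |Qr|`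
(`φ_L(t) = e^{-Lt}δ + ∫₀ᵗ Qr(s) e^{-L(t-s)} ds`). [folklore] -/
theorem abs_duhamelScalar_le_of_nonneg {δ L t Cq : ℝ} {Qr : ℝ → ℝ} (hL : 0 ≤ L) (ht : 0 ≤ t)
    (hQ : ∀ s ∈ Icc (0 : ℝ) t, |Qr s| ≤ Cq) :
    |duhamelScalar δ Qr L t| ≤ |δ| + t * Cq := by
  have hCq : 0 ≤ Cq := (abs_nonneg _).trans (hQ 0 ⟨le_rfl, ht⟩)
  have hexp1 : Real.exp (-(L * t)) ≤ 1 := by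
    rw [Real.exp_le_one_iff]
    nlinarith
  have hint : |∫ s in (0 : ℝ)..t, Qr s * Real.exp (L * s)| ≤ Cq * Real.exp (L * t) * t := by
    have h := intervalIntegral.norm_integral_le_of_norm_le_const (a := 0) (b := t)
      (C := Cq * Real.exp (L * t)) (f := fun s => Qr s * Real.exp (L * s)) fun s hs => by
        rw [uIoc_of_le ht] at hs
        rw [norm_mul, Real.norm_eq_abs, Real.norm_eq_abs, abs_of_pos (Real.exp_pos _)]
        exact mul_le_mul (hQ s ⟨hs.1.le, hs.2⟩) (Real.exp_le_exp.2 (by nlinarith [hs.2]))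
          (Real.exp_pos _).le hCq
    rw [Real.norm_eq_abs, sub_zero, abs_of_nonneg ht] at h
    exact h
  rw [duhamelScalar, abs_mul, Real.abs_exp]
  calc Real.exp (-(L * t)) * |δ + ∫ s in (0 : ℝ)..t, Qr s * Real.exp (L * s)|
      ≤ Real.exp (-(L * t)) * (|δ| + Cq * Real.exp (L * t) * t) :=
        mul_le_mul_of_nonneg_left ((abs_add_le _ _).trans (by linarith)) (Real.exp_pos _).le
    _ = Real.exp (-(L * t)) * |δ| + t * Cq * (Real.exp (-(L * t)) * Real.exp (L * t)) := by ring
    _ = Real.exp (-(L * t)) * |δ| + t * Cq := by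
        rw [← Real.exp_add, neg_add_cancel, Real.exp_zero, mul_one]
    _ ≤ |δ| + t * Cq := by nlinarith [abs_nonneg δ]

/-- Neighbouring scales have comparable weights: for `1 ≤ a ≤ 2` and `n ≤ k + 1`,
`1 + a^{10n} ≤ 2^{10}(1 + a^{10k})`. [folklore] -/
theorem weight_shift_le {a : ℝ} (ha1 : 1 ≤ a) (ha2 : a ≤ 2) {n k : ℤ} (h : n ≤ k + 1) :
    1 + (a ^ n) ^ 10 ≤ 2 ^ 10 * (1 + (a ^ k) ^ 10) := by
  have ha0 : 0 < a := by linarith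
  have h1 : a ^ n ≤ a ^ k * a := by
    calc a ^ n ≤ a ^ (k + 1) := zpow_le_zpow_right₀ ha1 h
      _ = a ^ k * a := zpow_add_one₀ ha0.ne' k
  have h2 : (a ^ n) ^ 10 ≤ (a ^ k) ^ 10 * 2 ^ 10 := by
    calc (a ^ n) ^ 10 ≤ (a ^ k * a) ^ 10 := pow_le_pow_left₀ (zpow_nonneg ha0.le _) h1 10
      _ = (a ^ k) ^ 10 * a ^ 10 := mul_pow _ _ _
      _ ≤ (a ^ k) ^ 10 * 2 ^ 10 := by gcongr
  nlinarith [pow_nonneg (zpow_nonneg ha0.le k) 10]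

/-- `c^{5/2} ≤ c² + c³` for `c > 0`. [folklore] -/
theorem rpow_five_halves_le {c : ℝ} (hc : 0 < c) : c ^ ((5 : ℝ) / 2) ≤ c ^ 2 + c ^ 3 := by
  rcases le_or_gt 1 c with h1 | h1
  · calc c ^ ((5 : ℝ) / 2) ≤ c ^ ((3 : ℕ) : ℝ) := Real.rpow_le_rpow_of_exponent_le h1 (by norm_num)
      _ = c ^ 3 := Real.rpow_natCast c 3
      _ ≤ c ^ 2 + c ^ 3 := by nlinarith [pow_pos hc 2]
  · calc c ^ ((5 : ℝ) / 2) ≤ c ^ ((2 : ℕ) : ℝ) :=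
          Real.rpow_le_rpow_of_exponent_ge hc h1.le (by norm_num)
      _ = c ^ 2 := Real.rpow_natCast c 2
      _ ≤ c ^ 2 + c ^ 3 := by nlinarith [pow_pos hc 3]

/-- **Bound on the circuit nonlinearity from the weighted coefficient bound**: if
`(1+(1+ε₀)^{10k})|X_{j,k}(s)| ≤ C` for all modes, then
`|quadTerm_{i,n}(X(s))| ≤ K_α ((1+ε₀)^{2n}+(1+ε₀)^{3n}) (2^{10}C/(1+(1+ε₀)^{10n}))²`,
`K_α = ∑ |α|` (the shifts move the scale by at most one; `(1+ε₀)^{5(n-μ₃)/2} ≤ (1+ε₀)^{5n/2}`). [cite: Tao2016AveragedNS, §4 (4.8)] -/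
theorem abs_quadTerm_le (hε₀ : 0 < ε₀) (hε₁ : ε₀ < 1) (α : Fin m → Fin m → Fin m → ℤ × ℤ × ℤ → ℝ)
    (X : Fin m → ℤ → ℝ → ℝ) {C s : ℝ}
    (hX : ∀ (j : Fin m) (k : ℤ), (1 + ((1 + ε₀) ^ k) ^ 10) * |X j k s| ≤ C) (i : Fin m) (n : ℤ) :
    |TaoCascade.quadTerm ε₀ α X i n s| ≤
      (∑ i₃ : Fin m, ∑ i₁ : Fin m, ∑ i₂ : Fin m, ∑ μ ∈ TaoCascade.shiftSet, |α i₁ i₂ i₃ μ|) *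
        ((((1 + ε₀) ^ n) ^ 2 + ((1 + ε₀) ^ n) ^ 3) * (2 ^ 10 * C / (1 + ((1 + ε₀) ^ n) ^ 10)) ^ 2) := by
  set a : ℝ := 1 + ε₀ with ha
  have ha0 : 0 < a := by rw [ha]; linarith
  have ha1 : 1 ≤ a := by rw [ha]; linarith
  have ha2 : a ≤ 2 := by rw [ha]; linarith
  set c : ℝ := a ^ n with hc
  have hc0 : 0 < c := zpow_pos ha0 n
  set w : ℝ := 1 + c ^ 10 with hw
  have hw0 : 0 < w := by positivity
  have hC0 : 0 ≤ C := le_trans (by positivity) (hX i n)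
  have hCw : 0 ≤ 2 ^ 10 * C / w := by positivity
  -- the coefficients at the shifted scales
  have hXb : ∀ (j : Fin m) (k : ℤ), n ≤ k + 1 → |X j k s| ≤ 2 ^ 10 * C / w := by
    intro j k hk
    have hwk : 0 < 1 + (a ^ k) ^ 10 := by positivity
    have h1 : |X j k s| ≤ C / (1 + (a ^ k) ^ 10) := by
      rw [le_div_iff₀ hwk, mul_comm]
      exact hX j k
    refine h1.trans ?_
    rw [div_le_div_iff₀ hwk hw0]
    calc C * w ≤ C * (2 ^ 10 * (1 + (a ^ k) ^ 10)) :=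
          mul_le_mul_of_nonneg_left (weight_shift_le ha1 ha2 hk) hC0
      _ = 2 ^ 10 * C * (1 + (a ^ k) ^ 10) := by ring
  -- the scale factor
  have hpow : ∀ μ₃ : ℤ, 0 ≤ μ₃ → a ^ ((5 : ℝ) * ((n : ℝ) - (μ₃ : ℝ)) / 2) ≤ c ^ 2 + c ^ 3 := by
    intro μ₃ hμ₃
    have hμ₃' : (0 : ℝ) ≤ μ₃ := by exact_mod_cast hμ₃
    calc a ^ ((5 : ℝ) * ((n : ℝ) - (μ₃ : ℝ)) / 2) ≤ a ^ ((n : ℝ) * (5 / 2)) :=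
          Real.rpow_le_rpow_of_exponent_le ha1 (by linarith)
      _ = c ^ ((5 : ℝ) / 2) := by rw [Real.rpow_mul ha0.le, Real.rpow_intCast]
      _ ≤ c ^ 2 + c ^ 3 := rpow_five_halves_le hc0
  -- shifts
  have hshift : ∀ μ ∈ TaoCascade.shiftSet, 0 ≤ μ.2.2 ∧ n ≤ (n - μ.2.2 + μ.1) + 1 ∧ n ≤ (n - μ.2.2 + μ.2.1) + 1 := by
    intro μ hμ
    rcases (TaoCascade.mem_shiftSet_iff μ).1 hμ with rfl | rfl | rfl | rfl <;> simp <;> omega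
  -- termwise
  have hterm : ∀ (i₁ i₂ : Fin m), ∀ μ ∈ TaoCascade.shiftSet,
      |α i₁ i₂ i μ * a ^ ((5 : ℝ) * ((n : ℝ) - (μ.2.2 : ℝ)) / 2) *
          (X i₁ (n - μ.2.2 + μ.1) s * X i₂ (n - μ.2.2 + μ.2.1) s)| ≤
        |α i₁ i₂ i μ| * ((c ^ 2 + c ^ 3) * (2 ^ 10 * C / w) ^ 2) := by
    intro i₁ i₂ μ hμ
    obtain ⟨hμ₃, hk₁, hk₂⟩ := hshift μ hμ
    rw [abs_mul, abs_mul, abs_mul, abs_of_pos (Real.rpow_pos_of_pos ha0 _)]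
    have h1 := hpow μ.2.2 hμ₃
    have h2 := hXb i₁ _ hk₁
    have h3 := hXb i₂ _ hk₂
    calc |α i₁ i₂ i μ| * a ^ ((5 : ℝ) * ((n : ℝ) - (μ.2.2 : ℝ)) / 2) *
          (|X i₁ (n - μ.2.2 + μ.1) s| * |X i₂ (n - μ.2.2 + μ.2.1) s|)
        ≤ |α i₁ i₂ i μ| * (c ^ 2 + c ^ 3) * ((2 ^ 10 * C / w) * (2 ^ 10 * C / w)) :=
          mul_le_mul (mul_le_mul_of_nonneg_left h1 (abs_nonneg _))
            (mul_le_mul h2 h3 (abs_nonneg _) hCw) (by positivity) (by positivity)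
      _ = |α i₁ i₂ i μ| * ((c ^ 2 + c ^ 3) * (2 ^ 10 * C / w) ^ 2) := by ring
  have hK : 0 ≤ (c ^ 2 + c ^ 3) * (2 ^ 10 * C / w) ^ 2 := by positivity
  unfold TaoCascade.quadTerm
  calc |∑ i₁ : Fin m, ∑ i₂ : Fin m, ∑ μ ∈ TaoCascade.shiftSet,
          α i₁ i₂ i μ * a ^ ((5 : ℝ) * ((n : ℝ) - (μ.2.2 : ℝ)) / 2) *
            (X i₁ (n - μ.2.2 + μ.1) s * X i₂ (n - μ.2.2 + μ.2.1) s)|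
      ≤ ∑ i₁ : Fin m, ∑ i₂ : Fin m, ∑ μ ∈ TaoCascade.shiftSet,
          |α i₁ i₂ i μ * a ^ ((5 : ℝ) * ((n : ℝ) - (μ.2.2 : ℝ)) / 2) *
            (X i₁ (n - μ.2.2 + μ.1) s * X i₂ (n - μ.2.2 + μ.2.1) s)| := by
        refine (Finset.abs_sum_le_sum_abs _ _).trans (Finset.sum_le_sum fun i₁ _ => ?_)
        refine (Finset.abs_sum_le_sum_abs _ _).trans (Finset.sum_le_sum fun i₂ _ => ?_)
        exact Finset.abs_sum_le_sum_abs _ _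
    _ ≤ ∑ i₁ : Fin m, ∑ i₂ : Fin m, ∑ μ ∈ TaoCascade.shiftSet,
          |α i₁ i₂ i μ| * ((c ^ 2 + c ^ 3) * (2 ^ 10 * C / w) ^ 2) :=
        Finset.sum_le_sum fun i₁ _ => Finset.sum_le_sum fun i₂ _ => Finset.sum_le_sum fun μ hμ =>
          hterm i₁ i₂ μ hμ
    _ = (∑ i₁ : Fin m, ∑ i₂ : Fin m, ∑ μ ∈ TaoCascade.shiftSet, |α i₁ i₂ i μ|) *
          ((c ^ 2 + c ^ 3) * (2 ^ 10 * C / w) ^ 2) := by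
        simp only [Finset.sum_mul]
    _ ≤ (∑ i₃ : Fin m, ∑ i₁ : Fin m, ∑ i₂ : Fin m, ∑ μ ∈ TaoCascade.shiftSet, |α i₁ i₂ i₃ μ|) *
          ((c ^ 2 + c ^ 3) * (2 ^ 10 * C / w) ^ 2) := by
        refine mul_le_mul_of_nonneg_right ?_ hK
        exact Finset.single_le_sum
          (f := fun i₃ : Fin m => ∑ i₁ : Fin m, ∑ i₂ : Fin m, ∑ μ ∈ TaoCascade.shiftSet, |α i₁ i₂ i₃ μ|)
          (fun _ _ => by positivity) (Finset.mem_univ i)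

/-- **Summability of the mode bounds over the scales** (both directions `n → ±∞`):
`∑_{n ∈ ℤ} ((aⁿ)²+(aⁿ)³)²/(1+(aⁿ)^{10})² < ∞` for `a > 1` (geometric comparison with `4a^{-|n|}`). [folklore] -/
theorem summable_decay {a : ℝ} (ha : 1 < a) :
    Summable fun n : ℤ => ((a ^ n) ^ 2 + (a ^ n) ^ 3) ^ 2 / (1 + (a ^ n) ^ 10) ^ 2 := by
  have ha0 : 0 < a := by linarith
  have hr0 : 0 ≤ a⁻¹ := by positivity
  have hr1 : a⁻¹ < 1 := inv_lt_one_of_one_lt₀ ha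
  have hgeo : Summable fun n : ℕ => 4 * (a⁻¹) ^ n := (summable_geometric_of_lt_one hr0 hr1).mul_left 4
  refine Summable.of_nat_of_neg ?_ ?_
  · refine Summable.of_nonneg_of_le (fun n => by positivity) (fun n => ?_) hgeo
    simp only [zpow_natCast]
    have hc1 : 1 ≤ a ^ n := one_le_pow₀ ha.le
    have hc0 : 0 < a ^ n := by positivity
    have h1 : (a ^ n) ^ 2 ≤ (a ^ n) ^ 3 := pow_le_pow_right₀ hc1 (by norm_num)
    have h2 : ((a ^ n) ^ 2 + (a ^ n) ^ 3) ^ 2 ≤ (2 * (a ^ n) ^ 3) ^ 2 :=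
      pow_le_pow_left₀ (by positivity) (by linarith) 2
    have h3 : (a ^ n) ^ 7 ≤ (1 + (a ^ n) ^ 10) ^ 2 := by
      calc (a ^ n) ^ 7 ≤ (a ^ n) ^ 20 := pow_le_pow_right₀ hc1 (by norm_num)
        _ = ((a ^ n) ^ 10) ^ 2 := by ring
        _ ≤ (1 + (a ^ n) ^ 10) ^ 2 := pow_le_pow_left₀ (by positivity) (by linarith) 2
    rw [div_le_iff₀ (by positivity), inv_pow]
    calc ((a ^ n) ^ 2 + (a ^ n) ^ 3) ^ 2 ≤ (2 * (a ^ n) ^ 3) ^ 2 := h2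
      _ = 4 * (a ^ n)⁻¹ * (a ^ n) ^ 7 := by field_simp; ring
      _ ≤ 4 * (a ^ n)⁻¹ * (1 + (a ^ n) ^ 10) ^ 2 := by gcongr
  · refine Summable.of_nonneg_of_le (fun n => by positivity) (fun n => ?_) hgeo
    rw [zpow_neg, zpow_natCast, ← inv_pow]
    have hd0 : 0 < a⁻¹ ^ n := by positivity
    have hd1 : a⁻¹ ^ n ≤ 1 := pow_le_one₀ hr0 hr1.le
    have h1 : (a⁻¹ ^ n) ^ 3 ≤ (a⁻¹ ^ n) ^ 2 := pow_le_pow_of_le_one hd0.le hd1 (by norm_num)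
    have h2 : ((a⁻¹ ^ n) ^ 2 + (a⁻¹ ^ n) ^ 3) ^ 2 ≤ (2 * (a⁻¹ ^ n) ^ 2) ^ 2 :=
      pow_le_pow_left₀ (by positivity) (by linarith) 2
    have h3 : (a⁻¹ ^ n) ^ 4 ≤ (a⁻¹ ^ n) ^ 1 := pow_le_pow_of_le_one hd0.le hd1 (by norm_num)
    calc ((a⁻¹ ^ n) ^ 2 + (a⁻¹ ^ n) ^ 3) ^ 2 / (1 + (a⁻¹ ^ n) ^ 10) ^ 2
        ≤ ((a⁻¹ ^ n) ^ 2 + (a⁻¹ ^ n) ^ 3) ^ 2 :=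
          div_le_self (by positivity) (one_le_pow₀ (by nlinarith [pow_nonneg hd0.le 10]))
      _ ≤ (2 * (a⁻¹ ^ n) ^ 2) ^ 2 := h2
      _ = 4 * (a⁻¹ ^ n) ^ 4 := by ring
      _ ≤ 4 * (a⁻¹ ^ n) ^ 1 := by gcongr
      _ = 4 * a⁻¹ ^ n := by rw [pow_one]

/-- **Registered sub-goal `stub_bandField_fibreDecay`** (closed form of `summable_decay`, the helper
this file serves for `stub_bandField_exists`): `∑_{n∈ℤ} ((aⁿ)²+(aⁿ)³)²/(1+(aⁿ)^{10})² < ∞` for `a > 1`. [folklore] -/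
theorem stub_bandField_fibreDecay :
    ∀ a : ℝ, 1 < a → Summable fun n : ℤ => ((a ^ n) ^ 2 + (a ^ n) ^ 3) ^ 2 / (1 + (a ^ n) ^ 10) ^ 2 :=
  fun _ ha => summable_decay ha

end Summit.NavierStokesRegularity.NavierStokesRegularity.Theorems.PerpetualPumpPumpTransfer

end
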